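import Literature.Probability.LatticeModels.PhantomHarmonicComparison
import Literature.Probability.LatticeModels.HalfPlanePoissonKernel
import HarnessLib

/-!
# The segment barrier: DCHN's Lemma 11, second item, for the phantom-weighted Laplacian

Topic `Literature/Probability/LatticeModels`; discrete potential theory for the Russo–Seymour–Welsh
programme for the critical FK-Ising model after H. Duminil-Copin, C. Hongler, P. Nolin,
*Connection probabilities and RSW-type bounds for the two-dimensional FK Ising model*, Comm. Pure
Appl. Math. 64 (2011), arXiv:0912.4253 (DCHN). Everything here is PROVED; no named fact; no FK
object (statements about real functions on `ℤ²`).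

DCHN Lemma 11, second item: for a Dobrushin `ℍ`-domain, "if the segment `l_n(k) = {k} × [0, n]`
disconnects the wired arc from the origin inside the domain, then `H_•(B_0) ≤ c₄ n/|k|²`" — the
input of the key conditional bound `P(x ↔ wired arc | γ[0, T_{k+1}]) ≤ c₄ √(2^{k+1})/|x - y|` in
the proof of their Proposition 14 (the vertical segment from `γ(T_{k+1})` down to `ℤ` disconnects
the wired arc from `x`). As for the first item (`PhantomHarmonicComparison.dchn_lemma11_dist`), we
prove it as an explicit-barrier statement for subsolutions of the phantom Laplacian `L_{P,0}` with
*arbitrary* phantom directions `P` (so that it applies verbatim in slit domains), the barrier being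
a multiple of the Poisson kernel of the discrete half-plane (`HalfPlanePoissonKernel.hpPoisson`)
with its pole two rows below the foot of the segment:

  `segBarrier k n (m, y) = 4(n+2) · hpPoisson (m - k, y + 1)`.

* `segBarrier` is nonnegative, lattice-harmonic on the rows `y ≥ -1`, at least `1` on the segment
  `{k} × [0, n]` (`one_le_segBarrier`, from `K_s(0) ≥ 1/(4s)`), satisfies
  `segBarrier (x + e_j) ≥ ¼ segBarrier x ≥ (1 - w) segBarrier x` across every edge from the rows
  `y ≥ 0` (one-step Harnack), hence is an `L_{P,0}`-supersolution on `{y ≥ 0}` for every `P`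
  (`phantomLaplacian_segBarrier_nonpos`), and `segBarrier k n (m, 0) ≤ 16(n+2)/(π (m-k)²)`
  (`segBarrier_row_zero_le`, from `K_2(m) ≤ 4/(π m²)`).
* **`phantom_sub_le_segBarrier` / `dchn_lemma11_segment`**: if `S ⊆ {y ≥ 0}` is finite, `u` is an
  `L_{P,0}`-subsolution on `S`, and every non-phantom outer-boundary point `x` of `S` has `u x ≤ 0`,
  or `u x ≤ 1` and `x` on the segment `{k} × [0, n]`, then `u ≤ segBarrier k n` on `S`; in
  particular `u z ≤ 16(n+2)/(π (z₀ - k)²)` at every `z ∈ S` on the row `y = 0` with `z₀ ≠ k`.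
  For the black primitive `u = H_B - Hw` of a Dobrushin domain above the row `y = 0` (an
  `L_{P,0}`-subsolution with `u = 0` across the free arc and `u ≤ 1`, by
  `FKPrimitiveBoundaryLaplacian.phantom_laplacian_hw` and the bridge `phantomLaplacian_nonneg_of_hw`
  below), taking for `S` the sites reachable from `z` without entering the segment, the hypothesis
  says exactly that the segment disconnects the wired arc from `z`: DCHN's statement with
  `c₄ = 16 · 3/π < 16` (`n + 2 ≤ 3n`).
* `phantom_sub_le_at_source`: at a site with a phantom direction an `L_{P,0}`-subsolution with
  neighbours `≤ 1` is `≤ 3/(3+w)` (for the white primitive: `u∘ ≥ w/(3+w)` next to a wired edge).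
* `nonPhantomReach P D F z` (sites reachable from `z` by non-phantom steps inside `D ∖ F`): its
  non-phantom outer boundary lies in `F ∪ Dᶜ` (`phantomOuterBoundary_nonPhantomReach_subset`), which
  packages the comparison regions: `dchn_lemma11_segment_reach`, `dchn_lemma11_dist_reach`.
* Bridges from the tree's form of DCHN's eq. (modified_laplacian)
  (`FKPrimitiveBoundaryLaplacian.phantom_laplacian_hw`: weights `1` and `1 - (√2-1)²` with the
  phantom neighbours carrying the free level `H_B`) to `L_{P,0}`-subsolutions:
  `phantomLaplacian_nonneg_of_hw`, and the face version `phantomLaplacian_nonpos_of_hb`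
  (`L_{P,1}`-supersolution `H_B - Hb`).

## References

* H. Duminil-Copin, C. Hongler, P. Nolin, *Connection probabilities and RSW-type bounds for the
  two-dimensional FK Ising model*, Comm. Pure Appl. Math. 64 (2011) 1165–1198, §3.2, Lemma 11
  (second item) and §4, proof of Proposition 14 — bib key `DuminilCopinHonglerNolin2011`.
* G. Lawler, V. Limic, *Random Walk: A Modern Introduction* (2010), §6.2, §8.1 — bib key
  `LawlerLimic2010`.
-/

noncomputable section

namespace Literature.Probability.LatticeModels

open Finset Real

/-! ### Bridges from the tree's form of the modified Laplacian -/

/-- `1 - (√2 - 1)² = w`. [cite: DuminilCopinHonglerNolin2011, §3.1, eq. (modified_laplacian)] -/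
theorem one_sub_sqrt_two_sub_one_sq : 1 - (Real.sqrt 2 - 1) ^ 2 = phantomWeight := rfl

/-- **Bridge, black/site version.** If at a site `u` the tree's modified-Laplacian inequality
`∑_{k∉P} (Hw(u+e_k) - Hw u) + (1 - (√2-1)²) ∑_{k∈P} (Hw(u+e_k) - Hw u) ≤ 0` holds
(`FKPrimitiveBoundaryLaplacian.phantom_laplacian_hw`) and the phantom neighbours carry the free level
`H_B`, then `H_B - Hw` is an `L_{P,0}`-subsolution at `u`.
[cite: DuminilCopinHonglerNolin2011, §3.1, eq. (modified_laplacian)] -/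
theorem phantomLaplacian_nonneg_of_hw {P : Site 2 → Finset (Fin 4)} {Hw : Site 2 → ℝ} {HB : ℝ} {u : Site 2}
    (hph : ∀ k ∈ P u, Hw (u + cornerUnit k) = HB)
    (hineq : ∑ k ∈ univ.filter (fun k => k ∉ P u), (Hw (u + cornerUnit k) - Hw u) +
      (1 - (Real.sqrt 2 - 1) ^ 2) * ∑ k ∈ P u, (Hw (u + cornerUnit k) - Hw u) ≤ 0) :
    0 ≤ phantomLaplacian P 0 (fun v => HB - Hw v) u := by
  rw [one_sub_sqrt_two_sub_one_sq] at hineq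
  have hsum : ∑ k ∈ P u, (Hw (u + cornerUnit k) - Hw u) = ((P u).card : ℝ) * (HB - Hw u) := by
    calc ∑ k ∈ P u, (Hw (u + cornerUnit k) - Hw u) = ∑ k ∈ P u, (HB - Hw u) :=
          Finset.sum_congr rfl fun k hk => by rw [hph k hk]
      _ = ((P u).card : ℝ) * (HB - Hw u) := by rw [Finset.sum_const, nsmul_eq_mul]
  rw [hsum] at hineq
  rw [phantomLaplacian]
  have hs : ∑ k ∈ univ.filter (fun k => k ∉ P u), (HB - Hw (u + cornerUnit k) - (HB - Hw u)) =
      -∑ k ∈ univ.filter (fun k => k ∉ P u), (Hw (u + cornerUnit k) - Hw u) := by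
    rw [← Finset.sum_neg_distrib]
    refine Finset.sum_congr rfl fun k _ => ?_
    ring
  rw [hs]
  linarith

/-- **Bridge, white/face version.** If at a face `f` the tree's inequality
`∑_{j∉P} (Hb(f_j) - Hb f) - (1 - (√2-1)²) ∑_{j∈P} (Hb f - Hw(a_j)) ≥ 0` holds
(`FKPrimitiveBoundaryLaplacian.phantom_laplacian_hb`, the phantom sides being wired `A`–`A` edges
whose corners `a_j` carry the wired level `Hw(a_j) = H_A = H_B - 1`), then `H_B - Hb` is an
`L_{P,1}`-supersolution at `f` (faces indexed by `Site 2`, neighbours `f + e_j`).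
[cite: DuminilCopinHonglerNolin2011, §3.1, eq. (modified_laplacian)] -/
theorem phantomLaplacian_nonpos_of_hb {P : Site 2 → Finset (Fin 4)} {Hb : Site 2 → ℝ} {HwA : Fin 4 → ℝ} {HA HB : ℝ}
    (hAB : HB = HA + 1) {f : Site 2} (hA : ∀ j ∈ P f, HwA j = HA)
    (hineq : 0 ≤ ∑ j ∈ univ.filter (fun j => j ∉ P f), (Hb (f + cornerUnit j) - Hb f) -
      (1 - (Real.sqrt 2 - 1) ^ 2) * ∑ j ∈ P f, (Hb f - HwA j)) :
    phantomLaplacian P 1 (fun g => HB - Hb g) f ≤ 0 := by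
  have hsum : ∑ j ∈ P f, (Hb f - HwA j) = ((P f).card : ℝ) * (Hb f - HA) := by
    calc ∑ j ∈ P f, (Hb f - HwA j) = ∑ j ∈ P f, (Hb f - HA) :=
          Finset.sum_congr rfl fun j hj => by rw [hA j hj]
      _ = ((P f).card : ℝ) * (Hb f - HA) := by rw [Finset.sum_const, nsmul_eq_mul]
  rw [one_sub_sqrt_two_sub_one_sq, hsum] at hineq
  rw [phantomLaplacian]
  have hs : ∑ j ∈ univ.filter (fun j => j ∉ P f), (HB - Hb (f + cornerUnit j) - (HB - Hb f)) =
      -∑ j ∈ univ.filter (fun j => j ∉ P f), (Hb (f + cornerUnit j) - Hb f) := by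
    rw [← Finset.sum_neg_distrib]
    refine Finset.sum_congr rfl fun k _ => ?_
    ring
  rw [hs, hAB]
  linarith

/-! ### The segment barrier -/

section SegBarrier

variable (k : ℤ) (n : ℕ)

/-- The pole offset: two rows below the foot `(k, 0)` of the segment, i.e. the translation taking
`(m, y)` to `(m - k, y + 1)` in the coordinates of `hpPoisson` (whose pole row is `-1`). [folklore] -/
def segShift : Site 2 := ![-k, 1]

/-- **The segment barrier** `segBarrier k n (m, y) = 4(n+2) · hpPoisson (m - k, y + 1)`.
[cite: DuminilCopinHonglerNolin2011, §3.2, Lemma 11, second item] -/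
def segBarrier (v : Site 2) : ℝ := 4 * ((n : ℝ) + 2) * hpPoisson (v + segShift k)

variable {k n}

/-- Coordinates of the shifted site. [folklore] -/
theorem add_segShift_apply (v : Site 2) : (v + segShift k) 0 = v 0 - k ∧ (v + segShift k) 1 = v 1 + 1 := by
  simp [segShift, sub_eq_add_neg]

/-- The barrier is nonnegative. [folklore] -/
theorem segBarrier_nonneg (v : Site 2) : 0 ≤ segBarrier k n v :=
  mul_nonneg (by positivity) (hpPoisson_nonneg _)

/-- Translation commutes with the lattice Laplacian (local copy of
`LatticeDobrushin.latticeLaplacian_comp_add` of `FKIsingBarHarmonicBound.lean`, not imported here to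
keep this file free of FK objects). [folklore] -/
private theorem latticeLaplacian_comp_add_right (f : Site 2 → ℝ) (w v : Site 2) :
    latticeLaplacian (fun u => f (u + w)) v = latticeLaplacian f (v + w) := by
  simp only [latticeLaplacian, add_right_comm]

/-- The barrier is lattice-harmonic on the rows `y ≥ -1`. [folklore] -/
theorem latticeLaplacian_segBarrier {v : Site 2} (hv : -1 ≤ v 1) : latticeLaplacian (segBarrier k n) v = 0 := by
  have h1 : segBarrier k n = fun u => (4 * ((n : ℝ) + 2)) * (fun u' => hpPoisson (u' + segShift k)) u := rfl
  rw [h1, latticeLaplacian_const_mul, latticeLaplacian_comp_add_right, latticeLaplacian_hpPoisson, mul_zero]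
  rw [(add_segShift_apply v).2]
  omega

/-- **One-step Harnack for the barrier**: across an edge from `x` to `x + e_j` with
`(x + e_j)₁ ≥ -1`, `segBarrier x ≤ 4 segBarrier (x + e_j)`. [folklore] -/
theorem segBarrier_le_four_mul (x : Site 2) (j : Fin 4) (hx : -1 ≤ (x + cornerUnit j) 1) :
    segBarrier k n x ≤ 4 * segBarrier k n (x + cornerUnit j) := by
  unfold segBarrier
  have h := hpPoisson_le_four_mul (x + segShift k) j (by
    have := (add_segShift_apply (k := k) (x + cornerUnit j)).2
    rw [add_right_comm] at this
    rw [this]; omega)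
  rw [add_right_comm] at h
  nlinarith [h, show (0 : ℝ) ≤ 4 * ((n : ℝ) + 2) by positivity]

/-- **The barrier is at least `1` on the segment** `{k} × [0, n]`. [folklore] -/
theorem one_le_segBarrier {v : Site 2} (h0 : v 0 = k) (h1 : 0 ≤ v 1) (h2 : v 1 ≤ n) : 1 ≤ segBarrier k n v := by
  unfold segBarrier
  have hc := add_segShift_apply (k := k) v
  have hax := hpPoisson_axis_ge (v + segShift k) (by rw [hc.1, h0, sub_self]) (by rw [hc.2]; omega)
  rw [hc.2] at hax
  push_cast at hax
  have hv1 : (v 1 : ℝ) ≤ n := by exact_mod_cast h2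
  have hv0 : (0 : ℝ) ≤ v 1 := by exact_mod_cast h1
  have hpos : (0 : ℝ) < 4 * ((v 1 : ℝ) + 1 + 1) := by positivity
  calc (1 : ℝ) ≤ 4 * ((n : ℝ) + 2) * (1 / (4 * ((v 1 : ℝ) + 1 + 1))) := by
        rw [mul_one_div, le_div_iff₀ hpos]; nlinarith
    _ ≤ 4 * ((n : ℝ) + 2) * hpPoisson (v + segShift k) := mul_le_mul_of_nonneg_left hax (by positivity)

/-- **Size of the barrier on the row `y = 0`**: `segBarrier k n (m, 0) ≤ 16(n+2)/(π (m-k)²)` for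
`m ≠ k`. [folklore] -/
theorem segBarrier_row_zero_le {v : Site 2} (h1 : v 1 = 0) (h0 : v 0 ≠ k) :
    segBarrier k n v ≤ 16 * ((n : ℝ) + 2) / (π * ((v 0 : ℝ) - k) ^ 2) := by
  unfold segBarrier
  have hc := add_segShift_apply (k := k) v
  have hle := hpPoisson_le (v + segShift k) (by rw [hc.1]; exact sub_ne_zero.2 h0) (by rw [hc.2, h1]; norm_num)
  have e1 : (((v + segShift k) 1 : ℤ) : ℝ) + 1 = 2 := by
    rw [hc.2, h1]; norm_num
  have e0 : (((v + segShift k) 0 : ℤ) : ℝ) = (v 0 : ℝ) - k := by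
    rw [hc.1, Int.cast_sub]
  rw [e1, e0] at hle
  calc 4 * ((n : ℝ) + 2) * hpPoisson (v + segShift k) ≤ 4 * ((n : ℝ) + 2) * (2 * 2 / (π * ((v 0 : ℝ) - k) ^ 2)) :=
        mul_le_mul_of_nonneg_left hle (by positivity)
    _ = 16 * ((n : ℝ) + 2) / (π * ((v 0 : ℝ) - k) ^ 2) := by ring

/-- **The segment barrier is an `L_{P,0}`-supersolution on the rows `y ≥ 0`**, for every
assignment of phantom directions: it is harmonic there, nonnegative, and drops by at most the factor
`1/4 ≥ 1 - w` along any edge. [cite: DuminilCopinHonglerNolin2011, §3.2, Lemma 11] -/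
theorem phantomLaplacian_segBarrier_nonpos {P : Site 2 → Finset (Fin 4)} {v : Site 2} (hv : 0 ≤ v 1) :
    phantomLaplacian P 0 (segBarrier k n) v ≤ 0 := by
  refine phantomLaplacian_nonpos_of (latticeLaplacian_segBarrier (by omega)).le fun j _ => ?_
  rw [mul_zero, add_zero]
  have hj : -1 ≤ (v + cornerUnit j) 1 := by
    fin_cases j <;> simp [cornerUnit] <;> omega
  have h4 := segBarrier_le_four_mul (k := k) (n := n) v j hj
  have hw := one_sub_phantomWeight_le
  have hb := segBarrier_nonneg (k := k) (n := n) v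
  nlinarith [mul_le_mul_of_nonneg_right hw hb]

variable {P : Site 2 → Finset (Fin 4)} {S : Set (Site 2)}

/-- **DCHN Lemma 11, second item, barrier form.** Let `S ⊆ {y ≥ 0}` be finite, `P` any phantom
directions, `u` an `L_{P,0}`-subsolution on `S` such that every non-phantom outer-boundary point `x`
has `u x ≤ 0`, or `u x ≤ 1` and `x` lies on the segment `{k} × [0, n]`. Then `u ≤ segBarrier k n` on
`S`. [cite: DuminilCopinHonglerNolin2011, §3.2, Lemma 11, second item] -/
theorem phantom_sub_le_segBarrier (hS : S.Finite) (hSsub : ∀ v ∈ S, 0 ≤ v 1) {u : Site 2 → ℝ}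
    (hu : ∀ v ∈ S, 0 ≤ phantomLaplacian P 0 u v)
    (hb : ∀ x ∈ phantomOuterBoundary P S, u x ≤ 0 ∨ (u x ≤ 1 ∧ x 0 = k ∧ 0 ≤ x 1 ∧ x 1 ≤ n)) :
    ∀ v ∈ S, u v ≤ segBarrier k n v := by
  refine phantom_le_of_sub_super hS hu (fun v hv => phantomLaplacian_segBarrier_nonpos (hSsub v hv)) fun x hx => ?_
  rcases hb x hx with h0 | ⟨h1, hk, hy0, hyn⟩
  · exact h0.trans (segBarrier_nonneg x)
  · exact h1.trans (one_le_segBarrier hk hy0 hyn)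

/-- **DCHN Lemma 11, second item** (`H_•(B_0) ≤ c₄ n/k²`, here `u(z) ≤ 16(n+2)/(π (z₀-k)²)`):
under the hypotheses of `phantom_sub_le_segBarrier`, at every `z ∈ S` on the row `y = 0` off the
column of the segment. For the black primitive `H_B - Hw` of a Dobrushin domain above the row of `z`
and `S` the sites reachable from `z` avoiding the segment, the boundary hypothesis says that the
segment disconnects the wired arc from `z` inside the domain, as in DCHN.
[cite: DuminilCopinHonglerNolin2011, §3.2, Lemma 11, second item] -/
theorem dchn_lemma11_segment (hS : S.Finite) (hSsub : ∀ v ∈ S, 0 ≤ v 1) {u : Site 2 → ℝ}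
    (hu : ∀ v ∈ S, 0 ≤ phantomLaplacian P 0 u v)
    (hb : ∀ x ∈ phantomOuterBoundary P S, u x ≤ 0 ∨ (u x ≤ 1 ∧ x 0 = k ∧ 0 ≤ x 1 ∧ x 1 ≤ n))
    {z : Site 2} (hz : z ∈ S) (hz1 : z 1 = 0) (hz0 : z 0 ≠ k) :
    u z ≤ 16 * ((n : ℝ) + 2) / (π * ((z 0 : ℝ) - k) ^ 2) :=
  (phantom_sub_le_segBarrier hS hSsub hu hb z hz).trans (segBarrier_row_zero_le hz1 hz0)

/-- The bound of `dchn_lemma11_segment` for `n ≥ 1` in DCHN's shape `c₄ n / k²` with `c₄ = 16`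
(`16(n+2)/π ≤ 16 n` as `n + 2 ≤ 3n ≤ π n`). [cite: DuminilCopinHonglerNolin2011, §3.2, Lemma 11] -/
theorem dchn_lemma11_segment' (hS : S.Finite) (hSsub : ∀ v ∈ S, 0 ≤ v 1) {u : Site 2 → ℝ}
    (hu : ∀ v ∈ S, 0 ≤ phantomLaplacian P 0 u v) (hn : 1 ≤ n)
    (hb : ∀ x ∈ phantomOuterBoundary P S, u x ≤ 0 ∨ (u x ≤ 1 ∧ x 0 = k ∧ 0 ≤ x 1 ∧ x 1 ≤ n))
    {z : Site 2} (hz : z ∈ S) (hz1 : z 1 = 0) (hz0 : z 0 ≠ k) :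
    u z ≤ 16 * (n : ℝ) / ((z 0 : ℝ) - k) ^ 2 := by
  refine (dchn_lemma11_segment hS hSsub hu hb hz hz1 hz0).trans ?_
  have hn' : (1 : ℝ) ≤ n := by exact_mod_cast hn
  have hπ := Real.pi_gt_three
  have hmk : (0 : ℝ) < ((z 0 : ℝ) - k) ^ 2 := by
    have h' : (z 0 : ℝ) ≠ (k : ℝ) := by exact_mod_cast hz0
    have : (z 0 : ℝ) - k ≠ 0 := sub_ne_zero.2 h'
    positivity
  rw [div_le_div_iff₀ (by positivity) hmk]
  have : 16 * ((n : ℝ) + 2) ≤ 16 * n * π := by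
    nlinarith [mul_le_mul_of_nonneg_left hπ.le (by positivity : (0 : ℝ) ≤ 16 * n)]
  nlinarith [mul_le_mul_of_nonneg_right this hmk.le]

end SegBarrier

/-! ### The local bound at a site with a phantom direction -/

/-- **Sources pull subsolutions down.** If `u` is an `L_{P,0}`-subsolution at a site `v` having at
least one phantom direction, and `u ≤ 1` at the non-phantom neighbours of `v`, then
`u v ≤ 3/(3 + w)` (`< 0.79`): with `m ≤ 3` non-phantom and `c ≥ 1` phantom directions,
`0 ≤ L_{P,0} u (v) ≤ m (1 - u v) - w c · u v`. Read for `ũ = 1 - u∘` (`u∘ = H_B - Hb` the white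
primitive, an `L_{P,1}`-supersolution): next to a wired edge, `u∘ ≥ w/(3 + w)` — the local input of
lower bounds of DCHN Lemma 10 type. [cite: DuminilCopinHonglerNolin2011, §3.1–3.2] -/
theorem phantom_sub_le_at_source {P : Site 2 → Finset (Fin 4)} {u : Site 2 → ℝ} {v : Site 2}
    (hP : (P v).Nonempty) (hL : 0 ≤ phantomLaplacian P 0 u v)
    (hle : ∀ k : Fin 4, k ∉ P v → u (v + cornerUnit k) ≤ 1) :
    u v ≤ 3 / (3 + phantomWeight) := by
  have hw := phantomWeight_pos
  have hw1 := phantomWeight_lt_one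
  have hc1 : 1 ≤ (P v).card := Finset.card_pos.2 hP
  have hc4 : (P v).card ≤ 4 := by
    have h := Finset.card_le_univ (P v)
    rwa [Fintype.card_fin] at h
  have hmc : (univ.filter fun k : Fin 4 => k ∉ P v).card + (P v).card = 4 := by
    have h := Finset.card_filter_add_card_filter_not (s := (univ : Finset (Fin 4))) (p := fun k => k ∉ P v)
    have h2 : (univ.filter fun k : Fin 4 => ¬(k ∉ P v)) = P v := by
      ext k; simp
    rw [h2, Finset.card_univ, Fintype.card_fin] at h
    exact h
  have hsum : ∑ k ∈ univ.filter (fun k => k ∉ P v), (u (v + cornerUnit k) - u v) ≤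
      ((univ.filter fun k : Fin 4 => k ∉ P v).card : ℝ) * (1 - u v) := by
    calc ∑ k ∈ univ.filter (fun k => k ∉ P v), (u (v + cornerUnit k) - u v)
        ≤ ∑ k ∈ univ.filter (fun k => k ∉ P v), (1 - u v) :=
          Finset.sum_le_sum fun k hk => by
            rw [Finset.mem_filter] at hk
            linarith [hle k hk.2]
      _ = ((univ.filter fun k : Fin 4 => k ∉ P v).card : ℝ) * (1 - u v) := by
          rw [Finset.sum_const, nsmul_eq_mul]
  rw [phantomLaplacian] at hL
  have hcR : (1 : ℝ) ≤ (P v).card := by exact_mod_cast hc1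
  have hc4R : ((P v).card : ℝ) ≤ 4 := by exact_mod_cast hc4
  have hmR : ((univ.filter fun k : Fin 4 => k ∉ P v).card : ℝ) = 4 - (P v).card := by
    have : ((univ.filter fun k : Fin 4 => k ∉ P v).card : ℝ) + (P v).card = 4 := by exact_mod_cast hmc
    linarith
  obtain ⟨m, hm⟩ : ∃ m : ℝ, m = ((univ.filter fun k : Fin 4 => k ∉ P v).card : ℝ) := ⟨_, rfl⟩
  obtain ⟨c, hc⟩ : ∃ c : ℝ, c = ((P v).card : ℝ) := ⟨_, rfl⟩
  rw [← hm] at hsum hmR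
  rw [← hc] at hL hcR hc4R hmR
  have hm3 : m ≤ 3 := by linarith
  have hpos : 0 < m + phantomWeight * c := by nlinarith
  have hkey : u v * (m + phantomWeight * c) ≤ m := by linarith
  have h3 : m * (3 + phantomWeight) ≤ 3 * (m + phantomWeight * c) := by
    nlinarith [mul_le_mul_of_nonneg_right hm3 hw.le, mul_le_mul_of_nonneg_left hcR (by linarith : (0 : ℝ) ≤ 3 * phantomWeight)]
  rw [le_div_iff₀ (by linarith)]
  by_cases hu : u v ≤ 0
  · nlinarith
  · rw [not_le] at hu
    calc u v * (3 + phantomWeight)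
        = u v * (m + phantomWeight * c) * ((3 + phantomWeight) / (m + phantomWeight * c)) := by
          field_simp
      _ ≤ m * ((3 + phantomWeight) / (m + phantomWeight * c)) :=
          mul_le_mul_of_nonneg_right hkey (div_nonneg (by linarith) hpos.le)
      _ ≤ 3 := by
          rw [mul_div_assoc', div_le_iff₀ hpos]
          linarith

/-! ### Sets closed under non-phantom steps: packaging the comparison region -/

section Reach

variable (P : Site 2 → Finset (Fin 4)) (D F : Set (Site 2))

/-- One **non-phantom step inside `D ∖ F`**: from `a` to `b = a + e_k` with `k ∉ P a`, both ends in
`D` and off `F`. (In the applications `D` is the set of ordinary sites of a Dobrushin domain, `F` a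
separating segment.) [folklore] -/
def NonPhantomStep (a b : Site 2) : Prop :=
  a ∈ D ∧ a ∉ F ∧ b ∈ D ∧ b ∉ F ∧ ∃ k : Fin 4, k ∉ P a ∧ b = a + cornerUnit k

/-- The set of sites **reachable from `z` by non-phantom steps inside `D ∖ F`** — the comparison
region `S` of `dchn_lemma11_dist` / `dchn_lemma11_segment` ("the connected component of the origin
in `𝒟 ∖ l_k(-k)`", DCHN 2011, proof of Lemma 10). [folklore] -/
def nonPhantomReach (z : Site 2) : Set (Site 2) := {v | Relation.ReflTransGen (NonPhantomStep P D F) z v}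

variable {P D F} {z : Site 2}

/-- `z` is reachable from itself. [folklore] -/
theorem mem_nonPhantomReach_self : z ∈ nonPhantomReach P D F z := Relation.ReflTransGen.refl

/-- Reachable sites lie in `D ∖ F` (if `z` does). [folklore] -/
theorem nonPhantomReach_subset (hz : z ∈ D) (hzF : z ∉ F) : nonPhantomReach P D F z ⊆ D \ F := by
  intro v hv
  change Relation.ReflTransGen (NonPhantomStep P D F) z v at hv
  induction hv with
  | refl => exact ⟨hz, hzF⟩
  | tail _ hstep _ => exact ⟨hstep.2.2.1, hstep.2.2.2.1⟩

/-- The reachable set of a finite `D` is finite. [folklore] -/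
theorem nonPhantomReach_finite (hD : D.Finite) (hz : z ∈ D) (hzF : z ∉ F) : (nonPhantomReach P D F z).Finite :=
  hD.subset fun _ hv => (nonPhantomReach_subset hz hzF hv).1

/-- The reachable set is closed under non-phantom steps inside `D ∖ F`. [folklore] -/
theorem add_cornerUnit_mem_nonPhantomReach {v : Site 2} (hv : v ∈ nonPhantomReach P D F z) {k : Fin 4}
    (hk : k ∉ P v) (hvD : v ∈ D) (hvF : v ∉ F) (hxD : v + cornerUnit k ∈ D) (hxF : v + cornerUnit k ∉ F) :
    v + cornerUnit k ∈ nonPhantomReach P D F z :=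
  Relation.ReflTransGen.tail hv ⟨hvD, hvF, hxD, hxF, k, hk, rfl⟩

/-- **The non-phantom outer boundary of the reachable set lies in `F ∪ Dᶜ`**: a boundary point
reached by a non-phantom step is either on the separating set `F` or outside `D` (in the
applications: a wired site). This turns the boundary hypotheses of `dchn_lemma11_dist` /
`dchn_lemma11_segment` into statements about `F` and about the sites outside `D` that are one
non-phantom step away from the region. [folklore] -/
theorem phantomOuterBoundary_nonPhantomReach_subset (hz : z ∈ D) (hzF : z ∉ F) :
    phantomOuterBoundary P (nonPhantomReach P D F z) ⊆ F ∪ Dᶜ := by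
  rintro x ⟨hxS, v, hv, k, hk, rfl⟩
  by_contra hcon
  simp only [Set.mem_union, Set.mem_compl_iff, not_or, not_not] at hcon
  have hvDF := nonPhantomReach_subset hz hzF hv
  exact hxS (add_cornerUnit_mem_nonPhantomReach hv hk hvDF.1 hvDF.2 hcon.2 hcon.1)

/-- **DCHN Lemma 11, second item, for the reachable region.** Let `D` be a finite set of sites in
the rows `y ≥ 0`, `F` any set ("the segment"), `z ∈ D ∖ F` on the row `y = 0` with `z₀ ≠ k`, and `u`
an `L_{P,0}`-subsolution on the region `S` of sites reachable from `z` by non-phantom steps inside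
`D ∖ F`, with `u ≤ 1` on `F ∩ {k} × [0, n]`, `F ⊆ {k} × [0, n]` near `S` in the sense that every
point of `F` one non-phantom step from `S` lies on that segment, and `u ≤ 0` at every site outside
`D` one non-phantom step from `S` (for the primitive of a Dobrushin domain: no wired site is
reached, i.e. the segment disconnects the wired arc from `z`). Then
`u z ≤ 16(n+2)/(π (z₀ - k)²)`. [cite: DuminilCopinHonglerNolin2011, §3.2, Lemma 11, second item] -/
theorem dchn_lemma11_segment_reach {k : ℤ} {n : ℕ} (hD : D.Finite) (hDsub : ∀ v ∈ D, 0 ≤ v 1)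
    (hz : z ∈ D) (hzF : z ∉ F) (hz1 : z 1 = 0) (hz0 : z 0 ≠ k) {u : Site 2 → ℝ}
    (hu : ∀ v ∈ nonPhantomReach P D F z, 0 ≤ phantomLaplacian P 0 u v)
    (hF : ∀ x ∈ phantomOuterBoundary P (nonPhantomReach P D F z), x ∈ F →
      u x ≤ 1 ∧ x 0 = k ∧ 0 ≤ x 1 ∧ x 1 ≤ n)
    (hout : ∀ x ∈ phantomOuterBoundary P (nonPhantomReach P D F z), x ∉ D → u x ≤ 0) :
    u z ≤ 16 * ((n : ℝ) + 2) / (π * ((z 0 : ℝ) - k) ^ 2) := by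
  refine dchn_lemma11_segment (nonPhantomReach_finite hD hz hzF)
    (fun v hv => hDsub v (nonPhantomReach_subset hz hzF hv).1) hu (fun x hx => ?_)
    mem_nonPhantomReach_self hz1 hz0
  rcases phantomOuterBoundary_nonPhantomReach_subset hz hzF hx with hxF | hxD
  · exact Or.inr (hF x hx hxF)
  · exact Or.inl (hout x hx hxD)

/-- **DCHN Lemma 11, first item, for the reachable region** (`F = ∅`): with `D` a finite set of sites
in `{Y ≥ 0, |X| + Y ≤ d - 1}` around `z ∈ D` and `u` an `L_{P,0}`-subsolution on the sites reachable
from `z` by non-phantom steps inside `D`, if every site outside `D` one non-phantom step from the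
region has `u ≤ 0`, or `u ≤ 1` and lies on the `ℓ¹`-sphere of radius `d` (for the primitive: the
wired arc is at `ℓ¹`-distance `≥ d` from `z`), then `u z ≤ 4/(d+4)`.
[cite: DuminilCopinHonglerNolin2011, §3.2, Lemma 11, first item] -/
theorem dchn_lemma11_dist_reach {d : ℕ} (hd : 1 ≤ d) (hD : D.Finite)
    (hDsub : ∀ v ∈ D, 0 ≤ v 1 - z 1 ∧ |v 0 - z 0| + (v 1 - z 1) + 1 ≤ d) (hz : z ∈ D) {u : Site 2 → ℝ}
    (hu : ∀ v ∈ nonPhantomReach P D ∅ z, 0 ≤ phantomLaplacian P 0 u v)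
    (hout : ∀ x ∈ phantomOuterBoundary P (nonPhantomReach P D ∅ z), x ∉ D →
      u x ≤ 0 ∨ (u x ≤ 1 ∧ |x 0 - z 0| + (x 1 - z 1) = d)) :
    u z ≤ 4 / ((d : ℝ) + 4) := by
  have hzF : z ∉ (∅ : Set (Site 2)) := fun h => h
  refine dchn_lemma11_dist hd (nonPhantomReach_finite hD hz hzF)
    (fun v hv => hDsub v (nonPhantomReach_subset hz hzF hv).1) hu (fun x hx => ?_) mem_nonPhantomReach_self
  rcases phantomOuterBoundary_nonPhantomReach_subset hz hzF hx with hxF | hxD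
  · exact absurd hxF fun h => h
  · exact hout x hx hxD

end Reach

end Literature.Probability.LatticeModels
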